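import Literature.NumberTheory.EllipticCurves.Rank1Residual.CyclotomicWindingSpan
import HarnessLib

/-!
# LINE C `teichSpan-x9` on crux 19630 `SmallImageMuTransfer.AnalyticMuZeroX9` — the B⁰ vocabulary
# (Teichmüller packets of `Γ₀(N)`, the `ι`-involution, `TeichSpanGen N p`, `TeichSpanGenAll`)

Cell `bsd-f3-mu`, seat `p1` (gen 5), DEFINITIONS ONLY (plus proved bookkeeping lemmas; nothing asserted about
any level or curve).  This is §0 of the REGISTERED skeleton of LINE C `teichSpan-x9` on item
stmt-BirchSwinnertonDyer-19630 (planner of record `-imc` g9, `ledger skeleton check` 2026-08-27T23:28:47Z,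
skeleton sha16 `7a5ad0a1c1f02cfe`, stubs `stub_teichSpanGenAll` / `stub_teichOrbitNonConstantAt_of_teichSpanGenAll`),
VERBATIM — mathematics and Lean text of the eight definitions by the `-an` lens (g5, `HOME/an/g5/Sketch14.lean`
d62ff5e4807d21df, MEMO-an §14.11, CANDIDATES row 34 «AN-14») — filed as a separate tree module in the
skeleton's own namespace `Summit.BirchSwinnertonDyer.BirchSwinnertonDyer.Cruxes.AnalyticMuZeroX9.TeichSpan`, so
that (i) the stub files of the line (`…StubTeichOrbitNonConstantAtOfTeichSpanGenAll.lean`, this seat) and the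
eventual closer can `import` it and state the registered signatures with IDENTICAL fully-qualified names, and
(ii) the skeleton is re-registered with `import …TeichSpanDefs` replacing its §0 (same stubs, same text).
Appended (§1): `simp` lemmas on the entries of `iotaGamma0 γ` and the unfolding of `TeichSpanGenAll`, all proved.

The objects (Manin 1972 Prop. 1.4: `Γ₀(N) → H₁(X₀(N);ℤ)`, `γ ↦ {0 → γ·0}`, is a surjective homomorphism
killing the elliptic and parabolic elements; Mazur–Tate–Teitelbaum 1986 §I.10: the Teichmüller-orbit sums
of plus symbols are the Riemann sums of the `ω⁰`-branch of `L_p`):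
* `bEntry γ = b`, `iotaSL`, `iotaGamma0` — the involution `(a b; c d) ↦ (a −b; −c d)` (conjugation by
  `diag(−1,1)`; on symbols the complex conjugation `ι`, `{0 → x} ↦ {0 → −x}`);
* `IsTeichPacket N p n l` — a list of `p − 1` elements of `Γ₀(N)` with `d = pⁿ` whose `b`-entries are distinct
  mod `pⁿ` with a common `(p−1)`-th power, i.e. the cusps `γ·0 = b/pⁿ` run once through a Teichmüller coset
  `u·μ_{p−1} ⊂ (ℤ/pⁿ)ˣ` (under Manin's map the product goes to the averaged winding class `A_n(u) = Σ_η {0 → ηu/pⁿ}`,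
  the class paired with `φ_f⁺` in `Rank1Residual.teichOrbitSum`);
* `teichPacketProducts`, `teichSpanGenerators` (packet products ∪ finite-order ∪ trace-`±2` ∪ `p`-th powers);
* `TeichSpanGen N p` — CONJ B⁰(N,p): for every GOOD `γ` (`|d| = pᵐ`, `Rank1Residual.IsGoodAt`) the `ι`-norm
  `γ·γ^ι` lies in `⟨teichSpanGenerators N p⟩ · [Γ₀(N), Γ₀(N)]`; homologically `(1+ι)·V(N,p) ⊆ span_{𝔽_p}{A_n(u)}`;
* `TeichSpanGenAll` — B⁰ at every prime `p ≥ 5` and every level `N` prime to `p` (the registered stub 1; OPEN;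
  census `HOME/an/g5/B0-CENSUS-v1.tsv` d06d33567915a343, 61/61 pairs, `p ∈ {5,7}`, `N ≤ 1216`).

HONEST FRAMING: predicates only; `TeichSpanGenAll` is an OPEN conjecture of the cell (it contains Greenberg's
analytic `ω⁰`-conjecture at `p ≥ 5` for all irreducible images, MEMO-an §14.11 / §16); nothing here claims it.
beyond-print theorem: no.  BSD is not proved by any of this.

References: [Manin1972] Prop. 1.4; [MazurTateTeitelbaum1986Invent] §I.10 (10.1); [Sun2007] §4 (the un-averaged
span `M_n(ℓ)`; the averaged version is not in print); [Vaserstein1972SL2] (the attack language of stub 1).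
-/

noncomputable section

open scoped Classical MatrixGroups
open CongruenceSubgroup
open Literature.NumberTheory.EllipticCurves.Rank1Residual

-- the summit and its single problem are both named `BirchSwinnertonDyer` (registry layout D-0017)
set_option linter.dupNamespace false

namespace Summit.BirchSwinnertonDyer.BirchSwinnertonDyer.Cruxes.AnalyticMuZeroX9.TeichSpan

variable {N : ℕ}

/-! ### §0 The B⁰ vocabulary (VERBATIM §0 of the registered skeleton `teichSpan_x9.lean` 7a5ad0a1c1f02cfe =
`HOME/an/g5/Sketch14.lean`, -an g5; over the tree's `dEntry` / `trEntry` / `IsGoodAt` of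
`Rank1Residual.CyclotomicWindingSpan`) -/

/-- The upper-right entry `b` of `γ = (a b; c d) ∈ Γ₀(N)` (`γ·0 = b/d`). [cite: Manin1972, Prop. 1.4] -/
def bEntry (γ : Gamma0 N) : ℤ := (γ : SL(2, ℤ)) 0 1

/-- `ι`-conjugate in `SL₂(ℤ)`: `(a b; c d) ↦ (a −b; −c d)` = conjugation by `diag(−1,1) ∈ GL₂(ℤ)`; on the upper half
plane `z ↦ −z̄`, on modular symbols the complex-conjugation involution `ι`. [cite: Manin1972, Prop. 1.4] -/
def iotaSL (g : SL(2, ℤ)) : SL(2, ℤ) :=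
  ⟨!![(g : Matrix (Fin 2) (Fin 2) ℤ) 0 0, -((g : Matrix (Fin 2) (Fin 2) ℤ) 0 1);
      -((g : Matrix (Fin 2) (Fin 2) ℤ) 1 0), (g : Matrix (Fin 2) (Fin 2) ℤ) 1 1], by
    have h := g.det_coe
    rw [Matrix.det_fin_two] at h
    rw [Matrix.det_fin_two_of]
    linarith⟩

/-- The lower-left entry of `ι(g)` is `−c`. [cite: Manin1972, Prop. 1.4] -/
@[simp] theorem iotaSL_apply_10 (g : SL(2, ℤ)) :
    (iotaSL g : Matrix (Fin 2) (Fin 2) ℤ) 1 0 = -((g : Matrix (Fin 2) (Fin 2) ℤ) 1 0) := by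
  simp [iotaSL]

/-- `ι`-conjugate of `γ ∈ Γ₀(N)` (still in `Γ₀(N)`: the lower-left entry is negated). [cite: Manin1972, Prop. 1.4] -/
def iotaGamma0 (γ : Gamma0 N) : Gamma0 N :=
  ⟨iotaSL γ, by
    have h := Gamma0_mem.mp γ.2
    rw [Gamma0_mem, iotaSL_apply_10, Int.cast_neg, h, neg_zero]⟩

/-- A TEICHMÜLLER PACKET of `Γ₀(N)` at level `pⁿ`: a list of `p − 1` elements with `d`-entry `pⁿ` whose `b`-entries
are pairwise distinct mod `pⁿ` with a common `(p−1)`-th power — the cusps `γ·0 = b/pⁿ` run exactly once through a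
coset `u·μ_{p−1}(ℤ/pⁿ)` of the Teichmüller lifts; the product maps under Manin's `γ ↦ {0 → γ·0}` to the averaged
winding class `A_n(u) = Σ_η {0 → ηu/pⁿ}`, the class paired with `φ_f⁺` in `Rank1Residual.teichOrbitSum`.
[cite: Manin1972, Prop. 1.4] [cite: MazurTateTeitelbaum1986Invent, §I.10 (10.1)] -/
def IsTeichPacket (N p n : ℕ) (l : List (Gamma0 N)) : Prop :=
  l.length = p - 1 ∧ (∀ g ∈ l, dEntry g = (p : ℤ) ^ n) ∧
    (l.map fun g => ((bEntry g : ℤ) : ZMod (p ^ n))).Nodup ∧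
    ∃ c : ZMod (p ^ n), ∀ g ∈ l, ((bEntry g : ℤ) : ZMod (p ^ n)) ^ (p - 1) = c

/-- Products of Teichmüller packets (all levels `n ≥ 1`). [cite: Manin1972, Prop. 1.4] -/
def teichPacketProducts (N p : ℕ) : Set (Gamma0 N) :=
  {γ | ∃ (n : ℕ) (l : List (Gamma0 N)), 1 ≤ n ∧ IsTeichPacket N p n l ∧ γ = l.prod}

/-- Generators read «mod `p` in `H₁(X₀(N))`»: packet products, the elements dying in `H₁` (finite order, trace `±2`),
and `p`-th powers. [cite: Manin1972, Prop. 1.4] -/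
def teichSpanGenerators (N p : ℕ) : Set (Gamma0 N) :=
  teichPacketProducts N p ∪ {γ | IsOfFinOrder γ ∨ trEntry γ = 2 ∨ trEntry γ = -2} ∪
    {γ | ∃ h : Gamma0 N, γ = h ^ p}

/-- **CONJ B⁰(N,p) — `TeichSpanGen N p`** (AN-14, Teichmüller-averaged elementary generation): for every GOOD
`γ ∈ Γ₀(N)` (`|d| = pᵐ`) the `ι`-norm `γ·γ^ι` lies in the subgroup generated by the packet products, the finite-order and
trace-`±2` elements and the `p`-th powers, times the commutator subgroup; through Manin 1972 Prop. 1.4: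
`(1+ι)·V(N,p) ⊆ span_{𝔽_p}{A_n(u)}` in `H₁(X₀(N);𝔽_p)`.  A PREDICATE on `(N,p)`; nothing asserted.
[cite: Manin1972, Prop. 1.4] [cite: Sun2007, §4 — the un-averaged span `M_n(ℓ)`; the averaged version is not in print] -/
def TeichSpanGen (N p : ℕ) : Prop :=
  ∀ γ : Gamma0 N, IsGoodAt p γ →
    γ * iotaGamma0 γ ∈ Subgroup.closure (teichSpanGenerators N p) ⊔ commutator (Gamma0 N)

/-- **AN-14 (all levels) = CONJ B⁰ of cell `bsd-f3-mu`** (MEMO-an §14.11; the registered stub 1 of LINE C is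
`stub_teichSpanGenAll : TeichSpanGenAll`): `TeichSpanGen N p` for every prime `p ≥ 5` and every level `N` prime to
`p`.  The cell's OPEN CONJECTURE, stated as a closed `Prop` (VERBATIM the registered skeleton, as `ConjSpanGenAll` in
`Theorems/ConjSpanGenAllLevelsDefs.lean`); NOT a published result and not claimed here — nothing asserted.  CENSUS
(BC5): `HOME/an/g5/B0-CENSUS-v1.tsv` d06d33567915a343 — 61/61 (`p ∈ {5,7}`, `N ≤ 1216`).  Vocabulary: Manin 1972
Prop. 1.4 (see `TeichSpanGen`). -/
def TeichSpanGenAll : Prop := ∀ (N p : ℕ), p.Prime → 5 ≤ p → ¬ p ∣ N → TeichSpanGen N p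

/-! ### §1 Bookkeeping lemmas (all proved): the entries of `ι(γ)`, goodness of `ι(γ)`, unfolding -/

/-- The upper-left entry of `ι(g)` is `a`. [cite: Manin1972, Prop. 1.4] -/
@[simp] theorem iotaSL_apply_00 (g : SL(2, ℤ)) :
    (iotaSL g : Matrix (Fin 2) (Fin 2) ℤ) 0 0 = (g : Matrix (Fin 2) (Fin 2) ℤ) 0 0 := by
  simp [iotaSL]

/-- The upper-right entry of `ι(g)` is `−b`. [cite: Manin1972, Prop. 1.4] -/
@[simp] theorem iotaSL_apply_01 (g : SL(2, ℤ)) :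
    (iotaSL g : Matrix (Fin 2) (Fin 2) ℤ) 0 1 = -((g : Matrix (Fin 2) (Fin 2) ℤ) 0 1) := by
  simp [iotaSL]

/-- The lower-right entry of `ι(g)` is `d`. [cite: Manin1972, Prop. 1.4] -/
@[simp] theorem iotaSL_apply_11 (g : SL(2, ℤ)) :
    (iotaSL g : Matrix (Fin 2) (Fin 2) ℤ) 1 1 = (g : Matrix (Fin 2) (Fin 2) ℤ) 1 1 := by
  simp [iotaSL]

/-- The underlying `SL₂(ℤ)` element of `ι(γ)`, `γ ∈ Γ₀(N)`. [cite: Manin1972, Prop. 1.4] -/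
@[simp] theorem coe_iotaGamma0 (γ : Gamma0 N) : ((iotaGamma0 γ : Gamma0 N) : SL(2, ℤ)) = iotaSL γ := rfl

/-- `b(ι γ) = −b(γ)`: the cusp `ι(γ)·0 = −γ·0`. [cite: Manin1972, Prop. 1.4] -/
@[simp] theorem bEntry_iotaGamma0 (γ : Gamma0 N) : bEntry (iotaGamma0 γ) = -bEntry γ := by
  simp [bEntry, iotaGamma0, iotaSL]

/-- `d(ι γ) = d(γ)`. [cite: Manin1972, Prop. 1.4] -/
@[simp] theorem dEntry_iotaGamma0 (γ : Gamma0 N) : dEntry (iotaGamma0 γ) = dEntry γ := by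
  simp [dEntry, iotaGamma0, iotaSL]

/-- `tr(ι γ) = tr(γ)`. [cite: Manin1972, Prop. 1.4] -/
@[simp] theorem trEntry_iotaGamma0 (γ : Gamma0 N) : trEntry (iotaGamma0 γ) = trEntry γ := by
  simp [trEntry, iotaGamma0, iotaSL]

/-- `ι` preserves goodness: `|d(ιγ)| = |d(γ)| = pᵐ`. [cite: Sun2007, §4] -/
theorem isGoodAt_iotaGamma0 {p : ℕ} {γ : Gamma0 N} (h : IsGoodAt p γ) : IsGoodAt p (iotaGamma0 γ) := by
  obtain ⟨m, hm⟩ := h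
  exact ⟨m, by rw [dEntry_iotaGamma0, hm]⟩

/-- The `b`- and `d`-entries of an element of a Teichmüller packet: `d = pⁿ`. [cite: Manin1972, Prop. 1.4] -/
theorem dEntry_eq_of_isTeichPacket {p n : ℕ} {l : List (Gamma0 N)} (h : IsTeichPacket N p n l) {g : Gamma0 N}
    (hg : g ∈ l) : dEntry g = (p : ℤ) ^ n :=
  h.2.1 g hg

/-- Elements of a Teichmüller packet are good (`|d| = pⁿ`). [cite: Sun2007, §4] -/
theorem isGoodAt_of_isTeichPacket {p n : ℕ} {l : List (Gamma0 N)} (h : IsTeichPacket N p n l) {g : Gamma0 N}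
    (hg : g ∈ l) : IsGoodAt p g :=
  ⟨n, by rw [h.2.1 g hg, Int.natAbs_pow, Int.natAbs_natCast]⟩

/-- Unfolding `TeichSpanGenAll`. [cite: Manin1972, Prop. 1.4] -/
theorem teichSpanGenAll_iff :
    TeichSpanGenAll ↔ ∀ (N p : ℕ), p.Prime → 5 ≤ p → ¬ p ∣ N → TeichSpanGen N p := Iff.rfl

/-- Unfolding `TeichSpanGen`. [cite: Manin1972, Prop. 1.4] -/
theorem teichSpanGen_iff (N p : ℕ) :
    TeichSpanGen N p ↔ ∀ γ : Gamma0 N, IsGoodAt p γ →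
      γ * iotaGamma0 γ ∈ Subgroup.closure (teichSpanGenerators N p) ⊔ commutator (Gamma0 N) := Iff.rfl

/-- Packet products are generators. [cite: Manin1972, Prop. 1.4] -/
theorem prod_mem_teichSpanGenerators {p n : ℕ} {l : List (Gamma0 N)} (hn : 1 ≤ n) (h : IsTeichPacket N p n l) :
    l.prod ∈ teichSpanGenerators N p :=
  Or.inl (Or.inl ⟨n, l, hn, h, rfl⟩)

/-- Finite-order elements are generators. [cite: Manin1972, Prop. 1.4] -/
theorem mem_teichSpanGenerators_of_isOfFinOrder {p : ℕ} {γ : Gamma0 N} (h : IsOfFinOrder γ) :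
    γ ∈ teichSpanGenerators N p :=
  Or.inl (Or.inr (Or.inl h))

/-- Trace-`±2` elements are generators. [cite: Manin1972, Prop. 1.4] -/
theorem mem_teichSpanGenerators_of_trEntry {p : ℕ} {γ : Gamma0 N} (h : trEntry γ = 2 ∨ trEntry γ = -2) :
    γ ∈ teichSpanGenerators N p :=
  Or.inl (Or.inr (Or.inr h))

/-- `p`-th powers are generators. [cite: Manin1972, Prop. 1.4] -/
theorem pow_mem_teichSpanGenerators {p : ℕ} (h : Gamma0 N) : h ^ p ∈ teichSpanGenerators N p :=
  Or.inr ⟨h, rfl⟩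

end Summit.BirchSwinnertonDyer.BirchSwinnertonDyer.Cruxes.AnalyticMuZeroX9.TeichSpan

end
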